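import Summits.HubbardSuperconductivity.HubbardSuperconductivity.Theorems.TwTipContinuation.Negative.TipNormalForm
import Summits.HubbardSuperconductivity.HubbardSuperconductivity.Theorems.ThermalWedgeTwTipContinuationEdgeOrder

/-!
# `TwTipContinuation` (stmt-HubbardSuperconductivity-1700), line `isogap-submodular-transport`, skeleton v5:
# PENALTY-SIDE transport — the composition without Danskin or homogeneity, and the normal form of the one open stub

Seeded family `H_L(U,g) = hubbardTorus 2 L 1 U − (g/L²)P_L`, `P_L = (pairField d L)ᴴ(pairField d L)`, sector
`szSector (2n) 0`, `E_L(U,g) = minEnergyOn (H_L(U,g)) (szSector (2n) 0)`; the PENALISED pure torus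
`hubbardTorus 2 L 1 U + (s/L²)P_L` is `H_L(U,−s)` (`purePenalised_eq_negSeed`).

The v4 skeleton of the line (leads 0/c1) probed the pure corner `g = 0` from the attractive side: strip transport for
all widths `s ∈ (0,s₁]` ⇒ right-hand slope ⇒ Danskin attainment (`s ↓ 0`) ⇒ SOME ordered ground state ⇒ a separate
every-GS layer (`stub_groundSpaceHomogeneity`). This file records why the penalty side needs none of that:

* `penaltyCost_le_order` — LEFT chord at the pure corner in penalty form: for EVERY normalised sector ground state `ψ`
  of `hubbardTorus 2 L 1 U` and every `s > 0`, `E_L(U,−s) − E_L(U,0) ≤ (s/L²)·re⟨ψ,P_Lψ⟩` (one width, every GS, no limit);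
* `loss_of_order` — right chord on the edge: every-GS order `μL⁴` at seed `c − s` gives the loss `E(c−s) − E(c) ≥ μ s L²`;
* `everyGSOrder_of_penaltyTransportAt` — at one side `L`: edge order `μL⁴` at seed `c − s` + the penalty-transport
  inequality `E_L(0,c−s) − E_L(0,c) − ε s L² ≤ E_L(U,−s) − E_L(U,0)` ⇒ EVERY normalised sector GS of the pure torus has
  `re⟨P_L⟩ ≥ (μ − ε) L⁴`;
* `twTipContinuation_of_penaltyTransport` — **the v5 composition**: the open stub `stub_penaltyTransport` (as a
  hypothesis, verbatim) implies `TwTipContinuation`, using only the LANDED `stub_edgeOrder` (p79900), the chords and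
  `summitMatrix_of_everyGSOrder` / `twTipContinuation_of_uniformSummit`;
* NORMAL FORM of the open stub at one side `L` (what it really says, by the chords alone):
  `orderDominance_of_penaltyTransportAt` — NECESSARY: the inequality forces `re⟨φ,P_Lφ⟩ ≤ re⟨ψ,P_Lψ⟩ + εL⁴` for EVERY
  normalised GS `φ` of the free edge at seed `c − s` and EVERY normalised sector GS `ψ` of the pure torus (min-GS order of
  the pure torus dominates max-GS order of the edge at the lower seed);
  `penaltyTransportAt_of_penalisedOrderDominance` — SUFFICIENT: if EVERY normalised GS `χ` of the PENALISED pure torus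
  `hubbardTorus 2 L 1 U + (s/L²)P_L` dominates EVERY normalised GS `φ'` of the edge at the upper seed `c` up to `εL⁴`, the
  inequality holds.
So the one open stub of v5 is, eventually in `L` and up to the shift `c − s ↔ c` on the (exactly ordered) free edge and
`0 ↔ s` on the pure penalty, the statement "for every small `U` EVERY sector ground state of the pure torus has d-wave pair
intensity at least the reduced-BCS one at seed `≈ aU²`" — the `U`-uniform EVERY-ground-state weak-coupling d-wave order of
the pure 2D Hubbard torus with a BCS-calibrated rate, i.e. (by `twTipContinuation_iff_everyGSOrder_window`, p85630) the
crux's own conclusion with a rate: the line has no content left besides the open theorem itself. Folklore bookkeeping over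
the landed chords (`Negative/SeededChords`, Tasaki 2020 §2.1–2.2 variational principle); no definition is introduced.
-/

noncomputable section

namespace Summit.HubbardSuperconductivity.TwTipContinuation.IsogapTransport

open Matrix Filter Finset
open Literature.MathematicalPhysics.QuantumLattice Literature.Probability.LatticeModels
open Summit.HubbardSuperconductivity.HubbardSuperconductivity.Theses.ThermalWedge
open Summit.HubbardSuperconductivity.TwTipContinuation.Negative
open scoped ComplexOrder

/-! ### Chords at the pure corner, penalty form -/

/-- The penalised pure torus is the seeded family at the negative seed `−s`: `H + (s/L²)P_L = H − ((−s)/L²)P_L`.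
[folklore] -/
theorem purePenalised_eq_negSeed (U s : ℝ) (L : ℕ) [NeZero L] :
    hubbardTorus 2 L 1 U + ((s / (L : ℝ) ^ 2 : ℝ) : ℂ) • ((pairField dWaveFormFactor L)ᴴ * pairField dWaveFormFactor L) =
      hubbardTorus 2 L 1 U - (((-s) / (L : ℝ) ^ 2 : ℝ) : ℂ) • ((pairField dWaveFormFactor L)ᴴ * pairField dWaveFormFactor L) := by
  rw [neg_div, Complex.ofReal_neg, neg_smul, sub_neg_eq_add]

/-- **Left chord at the pure corner, penalty form**: for every normalised sector ground state `ψ` of the PURE torus and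
every penalty width `s > 0`, `E_L(U,−s) − E_L(U,0) ≤ (s/L²)·re⟨ψ,P_Lψ⟩` — the penalty cost bounds the pair intensity of
EVERY ground state from below (one width, no limit, no Danskin, no homogeneity). Tasaki 2020 §2.2. [folklore] -/
theorem penaltyCost_le_order {U s : ℝ} {L : ℕ} [NeZero L] {n : ℕ} (hs : 0 < s)
    {ψ : Fock (Orb (FermionTorus 2 L))} (hψ : star ψ ⬝ᵥ ψ = 1)
    (hgs : IsGroundStateInSector (hubbardTorus 2 L 1 U) (2 * n) 0 ψ) :
    (Matrix.minEnergyOn (hubbardTorus 2 L 1 U + ((s / (L : ℝ) ^ 2 : ℝ) : ℂ) • ((pairField dWaveFormFactor L)ᴴ * pairField dWaveFormFactor L)) (szSector (2 * n) 0))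
      - (Matrix.minEnergyOn (hubbardTorus 2 L 1 U) (szSector (2 * n) 0)) ≤
      s / (L : ℝ) ^ 2 * (expect ((pairField dWaveFormFactor L)ᴴ * pairField dWaveFormFactor L) ψ).re := by
  have hgs0 : IsGroundStateInSector (hubbardTorus 2 L 1 U - ((0 / (L : ℝ) ^ 2 : ℝ) : ℂ) • ((pairField dWaveFormFactor L)ᴴ * pairField dWaveFormFactor L)) (2 * n) 0 ψ := by
    rw [seededH_zero]; exact hgs
  have hl := leftChord_le_order (U := U) (g := 0) (g' := -s) (by linarith) hψ hgs0
  rw [seededH_zero, ← purePenalised_eq_negSeed, sub_neg_eq_add, zero_add] at hl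
  exact hl

/-- **Right chord at the penalised corner**: for every normalised sector ground state `χ` of the PENALISED pure torus
`hubbardTorus 2 L 1 U + (s/L²)P_L` (`s > 0`), `(s/L²)·re⟨χ,P_Lχ⟩ ≤ E_L(U,−s) − E_L(U,0)` — the penalty cost is at most the
(suppressed) pair intensity under the penalty. Tasaki 2020 §2.2. [folklore] -/
theorem penalisedOrder_le_penaltyCost {U s : ℝ} {L : ℕ} [NeZero L] {n : ℕ} (hs : 0 < s)
    {χ : Fock (Orb (FermionTorus 2 L))} (hχ : star χ ⬝ᵥ χ = 1)
    (hgs : IsGroundStateInSector (hubbardTorus 2 L 1 U + ((s / (L : ℝ) ^ 2 : ℝ) : ℂ) • ((pairField dWaveFormFactor L)ᴴ * pairField dWaveFormFactor L)) (2 * n) 0 χ) :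
    s / (L : ℝ) ^ 2 * (expect ((pairField dWaveFormFactor L)ᴴ * pairField dWaveFormFactor L) χ).re ≤
      (Matrix.minEnergyOn (hubbardTorus 2 L 1 U + ((s / (L : ℝ) ^ 2 : ℝ) : ℂ) • ((pairField dWaveFormFactor L)ᴴ * pairField dWaveFormFactor L)) (szSector (2 * n) 0))
        - (Matrix.minEnergyOn (hubbardTorus 2 L 1 U) (szSector (2 * n) 0)) := by
  rw [purePenalised_eq_negSeed] at hgs ⊢
  have hr := order_le_rightChord (U := U) (g := -s) (g'' := 0) (by linarith) hχ hgs
  rw [seededH_zero, sub_neg_eq_add, zero_add] at hr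
  exact hr

/-! ### Chords on the edge, loss form -/

/-- **Right chord on the edge, loss form**: every-GS order `μ L⁴` of the seeded torus at seed `c − s` (`s > 0`) forces the
loss `E_L(U,c−s) − E_L(U,c) ≥ μ s L²` (right chord at a normalised ground state at seed `c − s`, which exists in the sector
`(2n,0)`, `n ≤ L²`). Tasaki 2020 §2.2. [folklore] -/
theorem loss_of_order {U c s μ : ℝ} {L : ℕ} [NeZero L] {n : ℕ} (hn : n ≤ Fintype.card (FermionTorus 2 L)) (hs : 0 < s)
    (h : ∀ ψ : Fock (Orb (FermionTorus 2 L)), star ψ ⬝ᵥ ψ = 1 →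
      IsGroundStateInSector (hubbardTorus 2 L 1 U - (((c - s) / (L : ℝ) ^ 2 : ℝ) : ℂ) • ((pairField dWaveFormFactor L)ᴴ * pairField dWaveFormFactor L)) (2 * n) 0 ψ →
        μ * (L : ℝ) ^ 4 ≤ (expect ((pairField dWaveFormFactor L)ᴴ * pairField dWaveFormFactor L) ψ).re) :
    μ * s * (L : ℝ) ^ 2 ≤
      (Matrix.minEnergyOn (hubbardTorus 2 L 1 U - (((c - s) / (L : ℝ) ^ 2 : ℝ) : ℂ) • ((pairField dWaveFormFactor L)ᴴ * pairField dWaveFormFactor L)) (szSector (2 * n) 0))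
        - (Matrix.minEnergyOn (hubbardTorus 2 L 1 U - ((c / (L : ℝ) ^ 2 : ℝ) : ℂ) • ((pairField dWaveFormFactor L)ᴴ * pairField dWaveFormFactor L)) (szSector (2 * n) 0)) := by
  obtain ⟨φ, hφ, hφgs⟩ := exists_unit_groundState U (c - s) L hn
  have hr := order_le_rightChord (U := U) (g := c - s) (g'' := c) (by linarith) hφ hφgs
  have hb := h φ hφ hφgs
  have hL : (0 : ℝ) < (L : ℝ) ^ 2 := by
    have := NeZero.pos L
    positivity
  have key : (c - (c - s)) / (L : ℝ) ^ 2 * (μ * (L : ℝ) ^ 4) ≤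
      (c - (c - s)) / (L : ℝ) ^ 2 * (expect ((pairField dWaveFormFactor L)ᴴ * pairField dWaveFormFactor L) φ).re :=
    mul_le_mul_of_nonneg_left hb (div_nonneg (by linarith) hL.le)
  have hid : (c - (c - s)) / (L : ℝ) ^ 2 * (μ * (L : ℝ) ^ 4) = μ * s * (L : ℝ) ^ 2 := by
    field_simp
    ring
  linarith

/-- **Left chord on the edge, loss form**: for every normalised ground state `φ'` of the seeded torus at seed `c` and
`s > 0`, `E_L(U,c−s) − E_L(U,c) ≤ (s/L²)·re⟨φ',P_Lφ'⟩` (the loss is at most the pair intensity at the upper seed).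
Tasaki 2020 §2.2. [folklore] -/
theorem loss_le_order {U c s : ℝ} {L : ℕ} [NeZero L] {n : ℕ} (hs : 0 < s)
    {φ' : Fock (Orb (FermionTorus 2 L))} (hφ' : star φ' ⬝ᵥ φ' = 1)
    (hgs : IsGroundStateInSector (hubbardTorus 2 L 1 U - ((c / (L : ℝ) ^ 2 : ℝ) : ℂ) • ((pairField dWaveFormFactor L)ᴴ * pairField dWaveFormFactor L)) (2 * n) 0 φ') :
    (Matrix.minEnergyOn (hubbardTorus 2 L 1 U - (((c - s) / (L : ℝ) ^ 2 : ℝ) : ℂ) • ((pairField dWaveFormFactor L)ᴴ * pairField dWaveFormFactor L)) (szSector (2 * n) 0))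
        - (Matrix.minEnergyOn (hubbardTorus 2 L 1 U - ((c / (L : ℝ) ^ 2 : ℝ) : ℂ) • ((pairField dWaveFormFactor L)ᴴ * pairField dWaveFormFactor L)) (szSector (2 * n) 0)) ≤
      s / (L : ℝ) ^ 2 * (expect ((pairField dWaveFormFactor L)ᴴ * pairField dWaveFormFactor L) φ').re := by
  have hl := leftChord_le_order (U := U) (g := c) (g' := c - s) (by linarith) hφ' hgs
  have : (c - (c - s)) / (L : ℝ) ^ 2 = s / (L : ℝ) ^ 2 := by ring
  rw [this] at hl
  exact hl

/-! ### One side `L`: every-GS order from penalty transport, and the normal form of the open stub -/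

/-- **Every-GS order from penalty transport at one side.** If every normalised GS of the edge `H_L(V,c−s)` has order
`μL⁴` and the penalty-transport inequality `E_L(V,c−s) − E_L(V,c) − ε s L² ≤ E_L(U,−s) − E_L(U,0)` holds (`s > 0`), then
EVERY normalised sector ground state of the pure torus `hubbardTorus 2 L 1 U` has `re⟨P_L⟩ ≥ (μ − ε)L⁴` (right chord on the
edge, left chord at the pure corner; no Danskin, no homogeneity). [folklore] -/
theorem everyGSOrder_of_penaltyTransportAt {U V c s μ ε : ℝ} {L : ℕ} [NeZero L] {n : ℕ}
    (hn : n ≤ Fintype.card (FermionTorus 2 L)) (hs : 0 < s)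
    (hE : ∀ ψ : Fock (Orb (FermionTorus 2 L)), star ψ ⬝ᵥ ψ = 1 →
      IsGroundStateInSector (hubbardTorus 2 L 1 V - (((c - s) / (L : ℝ) ^ 2 : ℝ) : ℂ) • ((pairField dWaveFormFactor L)ᴴ * pairField dWaveFormFactor L)) (2 * n) 0 ψ →
        μ * (L : ℝ) ^ 4 ≤ (expect ((pairField dWaveFormFactor L)ᴴ * pairField dWaveFormFactor L) ψ).re)
    (hT : (Matrix.minEnergyOn (hubbardTorus 2 L 1 V - (((c - s) / (L : ℝ) ^ 2 : ℝ) : ℂ) • ((pairField dWaveFormFactor L)ᴴ * pairField dWaveFormFactor L)) (szSector (2 * n) 0))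
          - (Matrix.minEnergyOn (hubbardTorus 2 L 1 V - ((c / (L : ℝ) ^ 2 : ℝ) : ℂ) • ((pairField dWaveFormFactor L)ᴴ * pairField dWaveFormFactor L)) (szSector (2 * n) 0))
          - ε * s * (L : ℝ) ^ 2 ≤
        (Matrix.minEnergyOn (hubbardTorus 2 L 1 U + ((s / (L : ℝ) ^ 2 : ℝ) : ℂ) • ((pairField dWaveFormFactor L)ᴴ * pairField dWaveFormFactor L)) (szSector (2 * n) 0))
          - (Matrix.minEnergyOn (hubbardTorus 2 L 1 U) (szSector (2 * n) 0))) :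
    ∀ ψ : Fock (Orb (FermionTorus 2 L)), star ψ ⬝ᵥ ψ = 1 →
      IsGroundStateInSector (hubbardTorus 2 L 1 U) (2 * n) 0 ψ →
        (μ - ε) * (L : ℝ) ^ 4 ≤ (expect ((pairField dWaveFormFactor L)ᴴ * pairField dWaveFormFactor L) ψ).re := by
  intro ψ hψ hgs
  have hLpos : (0 : ℝ) < (L : ℝ) ^ 2 := by
    have := NeZero.pos L
    positivity
  have hA := loss_of_order (U := V) (c := c) (μ := μ) hn hs hE
  have hC := penaltyCost_le_order (U := U) hs hψ hgs
  have hkey : (μ - ε) * s * (L : ℝ) ^ 2 ≤ s / (L : ℝ) ^ 2 * (expect ((pairField dWaveFormFactor L)ᴴ * pairField dWaveFormFactor L) ψ).re := by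
    nlinarith
  have hkey' : s * ((μ - ε) * (L : ℝ) ^ 4) ≤ s * (expect ((pairField dWaveFormFactor L)ᴴ * pairField dWaveFormFactor L) ψ).re := by
    have h1 := mul_le_mul_of_nonneg_left hkey hLpos.le
    have e1 : (L : ℝ) ^ 2 * ((μ - ε) * s * (L : ℝ) ^ 2) = s * ((μ - ε) * (L : ℝ) ^ 4) := by ring
    have e2 : (L : ℝ) ^ 2 * (s / (L : ℝ) ^ 2 * (expect ((pairField dWaveFormFactor L)ᴴ * pairField dWaveFormFactor L) ψ).re) =
        s * (expect ((pairField dWaveFormFactor L)ᴴ * pairField dWaveFormFactor L) ψ).re := by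
      rw [← mul_assoc, mul_div_assoc', mul_div_cancel_left₀ s (ne_of_gt hLpos)]
    rw [e1, e2] at h1
    exact h1
  exact le_of_mul_le_mul_left hkey' hs

/-- **Normal form, necessary side** (chords only): at one side `L`, the penalty-transport inequality forces
`re⟨φ,P_Lφ⟩ ≤ re⟨ψ,P_Lψ⟩ + εL⁴` for EVERY normalised ground state `φ` of the edge `H_L(V,c−s)` and EVERY normalised sector
ground state `ψ` of the pure torus `hubbardTorus 2 L 1 U` — every-GS order dominance of the pure torus over the edge at the
lower seed. [folklore] -/
theorem orderDominance_of_penaltyTransportAt {U V c s ε : ℝ} {L : ℕ} [NeZero L] {n : ℕ} (hs : 0 < s)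
    (hT : (Matrix.minEnergyOn (hubbardTorus 2 L 1 V - (((c - s) / (L : ℝ) ^ 2 : ℝ) : ℂ) • ((pairField dWaveFormFactor L)ᴴ * pairField dWaveFormFactor L)) (szSector (2 * n) 0))
          - (Matrix.minEnergyOn (hubbardTorus 2 L 1 V - ((c / (L : ℝ) ^ 2 : ℝ) : ℂ) • ((pairField dWaveFormFactor L)ᴴ * pairField dWaveFormFactor L)) (szSector (2 * n) 0))
          - ε * s * (L : ℝ) ^ 2 ≤
        (Matrix.minEnergyOn (hubbardTorus 2 L 1 U + ((s / (L : ℝ) ^ 2 : ℝ) : ℂ) • ((pairField dWaveFormFactor L)ᴴ * pairField dWaveFormFactor L)) (szSector (2 * n) 0))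
          - (Matrix.minEnergyOn (hubbardTorus 2 L 1 U) (szSector (2 * n) 0)))
    {φ ψ : Fock (Orb (FermionTorus 2 L))} (hφ : star φ ⬝ᵥ φ = 1) (hψ : star ψ ⬝ᵥ ψ = 1)
    (hφgs : IsGroundStateInSector (hubbardTorus 2 L 1 V - (((c - s) / (L : ℝ) ^ 2 : ℝ) : ℂ) • ((pairField dWaveFormFactor L)ᴴ * pairField dWaveFormFactor L)) (2 * n) 0 φ)
    (hψgs : IsGroundStateInSector (hubbardTorus 2 L 1 U) (2 * n) 0 ψ) :
    (expect ((pairField dWaveFormFactor L)ᴴ * pairField dWaveFormFactor L) φ).re ≤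
      (expect ((pairField dWaveFormFactor L)ᴴ * pairField dWaveFormFactor L) ψ).re + ε * (L : ℝ) ^ 4 := by
  have hLpos : (0 : ℝ) < (L : ℝ) ^ 2 := by
    have := NeZero.pos L
    positivity
  have hr := order_le_rightChord (U := V) (g := c - s) (g'' := c) (by linarith) hφ hφgs
  have e0 : (c - (c - s)) / (L : ℝ) ^ 2 = s / (L : ℝ) ^ 2 := by ring
  rw [e0] at hr
  have hC := penaltyCost_le_order (U := U) hs hψ hψgs
  -- `(s/L²)·(re⟨φ⟩ − re⟨ψ⟩) ≤ ε s L²`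
  have hkey : s / (L : ℝ) ^ 2 * ((expect ((pairField dWaveFormFactor L)ᴴ * pairField dWaveFormFactor L) φ).re
      - (expect ((pairField dWaveFormFactor L)ᴴ * pairField dWaveFormFactor L) ψ).re) ≤ s / (L : ℝ) ^ 2 * (ε * (L : ℝ) ^ 4) := by
    have e1 : s / (L : ℝ) ^ 2 * (ε * (L : ℝ) ^ 4) = ε * s * (L : ℝ) ^ 2 := by
      calc s / (L : ℝ) ^ 2 * (ε * (L : ℝ) ^ 4) = (s / (L : ℝ) ^ 2 * (L : ℝ) ^ 2) * (ε * (L : ℝ) ^ 2) := by ring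
        _ = s * (ε * (L : ℝ) ^ 2) := by rw [div_mul_cancel₀ s (ne_of_gt hLpos)]
        _ = ε * s * (L : ℝ) ^ 2 := by ring
    rw [e1, mul_sub]
    linarith
  have hc : 0 < s / (L : ℝ) ^ 2 := div_pos hs hLpos
  have := le_of_mul_le_mul_left hkey hc
  linarith

/-- **Normal form, sufficient side** (chords only): at one side `L`, if EVERY normalised sector ground state `χ` of the
PENALISED pure torus `hubbardTorus 2 L 1 U + (s/L²)P_L` dominates EVERY normalised ground state `φ'` of the edge `H_L(V,c)` at
the upper seed, `re⟨φ',P_Lφ'⟩ ≤ re⟨χ,P_Lχ⟩ + εL⁴`, then the penalty-transport inequality holds (`n ≤ L²` for the existence of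
the two ground states). [folklore] -/
theorem penaltyTransportAt_of_penalisedOrderDominance {U V c s ε : ℝ} {L : ℕ} [NeZero L] {n : ℕ}
    (hn : n ≤ Fintype.card (FermionTorus 2 L)) (hs : 0 < s)
    (hdom : ∀ φ' χ : Fock (Orb (FermionTorus 2 L)), star φ' ⬝ᵥ φ' = 1 → star χ ⬝ᵥ χ = 1 →
      IsGroundStateInSector (hubbardTorus 2 L 1 V - ((c / (L : ℝ) ^ 2 : ℝ) : ℂ) • ((pairField dWaveFormFactor L)ᴴ * pairField dWaveFormFactor L)) (2 * n) 0 φ' →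
      IsGroundStateInSector (hubbardTorus 2 L 1 U + ((s / (L : ℝ) ^ 2 : ℝ) : ℂ) • ((pairField dWaveFormFactor L)ᴴ * pairField dWaveFormFactor L)) (2 * n) 0 χ →
        (expect ((pairField dWaveFormFactor L)ᴴ * pairField dWaveFormFactor L) φ').re ≤
          (expect ((pairField dWaveFormFactor L)ᴴ * pairField dWaveFormFactor L) χ).re + ε * (L : ℝ) ^ 4) :
    (Matrix.minEnergyOn (hubbardTorus 2 L 1 V - (((c - s) / (L : ℝ) ^ 2 : ℝ) : ℂ) • ((pairField dWaveFormFactor L)ᴴ * pairField dWaveFormFactor L)) (szSector (2 * n) 0))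
        - (Matrix.minEnergyOn (hubbardTorus 2 L 1 V - ((c / (L : ℝ) ^ 2 : ℝ) : ℂ) • ((pairField dWaveFormFactor L)ᴴ * pairField dWaveFormFactor L)) (szSector (2 * n) 0))
        - ε * s * (L : ℝ) ^ 2 ≤
      (Matrix.minEnergyOn (hubbardTorus 2 L 1 U + ((s / (L : ℝ) ^ 2 : ℝ) : ℂ) • ((pairField dWaveFormFactor L)ᴴ * pairField dWaveFormFactor L)) (szSector (2 * n) 0))
        - (Matrix.minEnergyOn (hubbardTorus 2 L 1 U) (szSector (2 * n) 0)) := by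
  have hLpos : (0 : ℝ) < (L : ℝ) ^ 2 := by
    have := NeZero.pos L
    positivity
  obtain ⟨φ', hφ', hφ'gs⟩ := exists_unit_groundState V c L hn
  obtain ⟨χ, hχ, hχgs⟩ := exists_unit_groundState U (-s) L hn
  rw [← purePenalised_eq_negSeed] at hχgs
  have hl := loss_le_order (U := V) (c := c) hs hφ' hφ'gs
  have hr := penalisedOrder_le_penaltyCost (U := U) hs hχ hχgs
  have hd := hdom φ' χ hφ' hχ hφ'gs hχgs
  have hkey : s / (L : ℝ) ^ 2 * (expect ((pairField dWaveFormFactor L)ᴴ * pairField dWaveFormFactor L) φ').re ≤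
      s / (L : ℝ) ^ 2 * (expect ((pairField dWaveFormFactor L)ᴴ * pairField dWaveFormFactor L) χ).re + ε * s * (L : ℝ) ^ 2 := by
    have h1 := mul_le_mul_of_nonneg_left hd (div_pos hs hLpos).le
    have e1 : s / (L : ℝ) ^ 2 * ((expect ((pairField dWaveFormFactor L)ᴴ * pairField dWaveFormFactor L) χ).re + ε * (L : ℝ) ^ 4) =
        s / (L : ℝ) ^ 2 * (expect ((pairField dWaveFormFactor L)ᴴ * pairField dWaveFormFactor L) χ).re + ε * s * (L : ℝ) ^ 2 := by
      have e0 : s / (L : ℝ) ^ 2 * (ε * (L : ℝ) ^ 4) = ε * s * (L : ℝ) ^ 2 := by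
        calc s / (L : ℝ) ^ 2 * (ε * (L : ℝ) ^ 4) = (s / (L : ℝ) ^ 2 * (L : ℝ) ^ 2) * (ε * (L : ℝ) ^ 2) := by ring
          _ = s * (ε * (L : ℝ) ^ 2) := by rw [div_mul_cancel₀ s (ne_of_gt hLpos)]
          _ = ε * s * (L : ℝ) ^ 2 := by ring
      rw [mul_add, e0]
    rw [e1] at h1
    exact h1
  linarith

/-! ### The v5 composition: the open stub implies the crux -/

/-- **Penalty transport implies `TwTipContinuation`** (the v5 composition of line `isogap-submodular-transport`, with its
one open stub `stub_penaltyTransport` as a hypothesis, verbatim): at the stub's doping `δ` and for `U ∈ (0,U₁]`, the LANDED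
edge order `stub_edgeOrder` (p79900) at seed `aU² − s > 0` gives `μ > 0`; the stub with `ε = μ/2` and
`everyGSOrder_of_penaltyTransportAt` give EVERY normalised sector ground state of `hubbardTorus 2 L 1 U` the bound
`re⟨P_L⟩ ≥ (μ/2)L⁴` eventually in even `L`; `summitMatrix_of_everyGSOrder` and `twTipContinuation_of_uniformSummit` conclude
(the RUNG antecedent of the crux is unused; no Danskin attainment, no ground-space homogeneity). [folklore] -/
theorem twTipContinuation_of_penaltyTransport :
    (∃ δ ∈ Set.Icc (1 / 10 : ℝ) (3 / 10), ∃ U₁ a : ℝ, 0 < U₁ ∧ 0 < a ∧ ∀ U ∈ Set.Ioc (0 : ℝ) U₁, ∃ s : ℝ, 0 < s ∧ s < a * U ^ 2 ∧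
      ∀ ε : ℝ, 0 < ε → ∃ L₀ : ℕ, ∀ (L : ℕ) [NeZero L], L₀ ≤ L → Even L →
        (Matrix.minEnergyOn (hubbardTorus 2 L 1 0 - (((a * U ^ 2 - s) / (L : ℝ) ^ 2 : ℝ) : ℂ) • ((pairField dWaveFormFactor L)ᴴ * pairField dWaveFormFactor L)) (szSector (2 * ⌊(1 - δ) * (L : ℝ) ^ 2 / 2⌋₊) 0))
          - (Matrix.minEnergyOn (hubbardTorus 2 L 1 0 - ((a * U ^ 2 / (L : ℝ) ^ 2 : ℝ) : ℂ) • ((pairField dWaveFormFactor L)ᴴ * pairField dWaveFormFactor L)) (szSector (2 * ⌊(1 - δ) * (L : ℝ) ^ 2 / 2⌋₊) 0))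
          - ε * s * (L : ℝ) ^ 2 ≤
        (Matrix.minEnergyOn (hubbardTorus 2 L 1 U + ((s / (L : ℝ) ^ 2 : ℝ) : ℂ) • ((pairField dWaveFormFactor L)ᴴ * pairField dWaveFormFactor L)) (szSector (2 * ⌊(1 - δ) * (L : ℝ) ^ 2 / 2⌋₊) 0))
          - (Matrix.minEnergyOn (hubbardTorus 2 L 1 U) (szSector (2 * ⌊(1 - δ) * (L : ℝ) ^ 2 / 2⌋₊) 0))) →
    TwTipContinuation := by
  intro hPT
  obtain ⟨δ, hδ3, U₁, a, hU₁, _ha, hT⟩ := hPT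
  have hδ : δ ∈ Set.Icc (1 / 10 : ℝ) (2 / 5) := ⟨hδ3.1, hδ3.2.trans (by norm_num)⟩
  refine twTipContinuation_of_uniformSummit ⟨U₁, hU₁, δ, hδ, fun U hU => ?_⟩
  apply summitMatrix_of_everyGSOrder
  have hδ' : (-1 : ℝ) ≤ δ := by linarith [hδ.1]
  obtain ⟨s, hs, hsa, hT'⟩ := hT U hU
  obtain ⟨μ, hμ, L₁, hE⟩ := stub_edgeOrder δ hδ (a * U ^ 2 - s) (by linarith)
  obtain ⟨L₂, hT''⟩ := hT' (μ / 2) (by positivity)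
  refine ⟨μ / 2, by positivity, max L₁ L₂, fun L _ hL hEv ψ hψ hgs => ?_⟩
  have hL₁ : L₁ ≤ L := le_trans (le_max_left _ _) hL
  have hL₂ : L₂ ≤ L := le_trans (le_max_right _ _) hL
  have hn : ⌊(1 - δ) * (L : ℝ) ^ 2 / 2⌋₊ ≤ Fintype.card (FermionTorus 2 L) := by
    rw [Summit.HubbardSuperconductivity.NoGo.card_fermionTorus_two]
    exact Summit.HubbardSuperconductivity.NoGo.floor_pairNumber_le δ hδ' L
  have h := everyGSOrder_of_penaltyTransportAt (U := U) (V := 0) (c := a * U ^ 2) (μ := μ) (ε := μ / 2) hn hs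
    (hE L hL₁ hEv) (hT'' L hL₂ hEv) ψ hψ hgs
  have : (μ - μ / 2) * (L : ℝ) ^ 4 = μ / 2 * (L : ℝ) ^ 4 := by ring
  linarith

end Summit.HubbardSuperconductivity.TwTipContinuation.IsogapTransport

end
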